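import Summits.QuantumFields.YangMills.Theorems.BalabanUVNodesK0AllTorusOfStepTokensGuardedZBLamAx
import Summits.QuantumFields.YangMills.Theorems.BalabanUVNodesK0V23DefsAx
import Summits.QuantumFields.YangMills.Theorems.BalabanUVNodesN07RecordDomainsAdm22
import Literature.MathematicalPhysics.QuantumFieldTheory.Balaban1983to89.Node00.CriticalOnFibreTopGuardedBPrint

/-!
# K0ᴬ (stmt-QuantumFields-27238 `Record13SepCoPHInhabitedAx`) — `…K0AllTorusOfStepTokensGuardedZBLamPrint` RE-CENTRED (OP 5a ∕ H3.3, the Ax EDITION): the `hDat` transfer of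
# `…GuardedZBLamAx` DISCHARGED at print's data predicate `Dat := dataSmall7LamTopOf F 2` — the V24-shaped K0ᴬ body with ONLY the Stage-2 seam `hseam` left displayed

Cell `pub-ymgap` (YM-PLAN Track A, D-0062), width seat `pub-ymgap-dag-n07-w3` (g22; dag-lead g40 HANDS-3 H3.3).  `--kind proof --supports stmt-QuantumFields-27238 --as helper`, COUNT-NEUTRAL.
THEOREMS ONLY (0 `def` ∕ `instance` ∕ `notation` ∕ `sorry`).  NEW additive leaf; k0-s1-w1 g9's `…GuardedZBLamPrint` (key 20541, K0⁷ aside) stays landed and true on its own text.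

WHAT THIS FILE IS.  The σ-IMAGE of `…K0AllTorusOfStepTokensGuardedZBLamPrint` (81 l.) under director-ym №467 (D)'s re-centring (σ as in `…GuardedZBLamAx`'s header: `gOfRecord₁₃ ↦ gOfRecord₁₃Ax`,
`betaOfRecord₁₃ ↦ betaOfRecord₁₃Ax`, `theta13OfThm1CCMWZB ↦ theta13OfThm1CCMWZBAx`, `Provisos₁₃SepCoPH ↦ …Ax`, `SlotsNondegenerate₁₃ ↦ …Ax`, `UbgOfRecord₁₃CoP θ ↦ UbgOfRecord₁₃CoPChi θ (chiβOfRecord₁₃Ax θ)`,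
`PartCompat₁₃ θ ↦ PartCompat₁₃Chi θ (chiβOfRecord₁₃Ax θ)`); n07's `blockSat_seqOfRecord` and P0's `dataSmall7LamTopOf_of_seq` are CENTRE-BLIND (θ-free) and reused verbatim.
* `hDat_dataSmall7LamTopOfAx` — the transfer at the re-centred 𝐃-partition numerics (`PartCompat₁₃Chi θ (chiβOfRecord₁₃Ax θ)`, running coupling `gOfRecord₁₃Ax θ p`), every `F`, θ-generic.
* ★★★ `record13SepCoPHBody_of_stubs1GBPrint_2P_3A'GBPrintZBAx_lam (hseam) (h1GB) (h2P) (h3A'GB) : ∀ F, ∃ θ : Stage13HParams F 2, θ.Provisos₁₃SepCoPHAx F 2 ∧ (θ.ZhUnity F 2 ∧ θ.SlotsNondegenerate₁₃Ax F 2) ∧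
  θ.Admissible F 2` — `…ZBLamAx` §5 at `DatF := fun F => dataSmall7LamTopOf F 2` with `hDat` discharged: the K0ᴬ BODY (LITERALLY the `F`-instances of `Record13SepCoPHInhabitedAx`'s body) from
  the seam, the V24 stub-1ᴮ text (= V23's, centre-blind), the stub-2′ text (verbatim) and the re-centred 3ᴬ′ᴮ text (`betaOfRecord₁₃Ax ∘ theta13OfThm1CCMWZBAx`, letters `Efl logz` generic —
  `K0V23DefsAx.AbsBetaBoxAtThm1WitnessCCMGenGridGZBAxAt F` is its `(0, 0)` instance, p803783).
* §3 `hseamAx_rfl` (POST-SEAM the re-centred seam IS `rfl`: `UbgOfRecord₁₃CoP_succ_chi`) and the BY-NAME doors `k0BodyAx_of_stub1B_of_2P_of_3B` ∕ `k0BodyAx_of_stub1B_of_2P_of_eps0B` — σ-images of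
  `K0V23Defs.k0Body_of_stub1B_of_2P_of_{3B,eps0B}` over the V24 texts `K0V23Defs.Prop8StepCoPGridGBAt` (centre-blind, verbatim) and `K0V23DefsAx.AbsBetaBoxAtThm1WitnessCCMGenGridGZB{,Eps0}AxAt` (p803783).
HONEST SCOPE (binding).  Bookkeeping; CONDITIONAL on `hseam` and on CANDIDATE stub texts (V24 is registered by plan g99, not here); nothing of Bałaban asserted or discharged; K0ᴬ 27238 ∕
K1ᴬ 27239 ∕ K3ᴬ 27247 OPEN; N07 ∕ N09 NOT discharged; counts unmoved (8∕28 · K 1∕4); R4 = the CONDITIONAL finite-𝕋⁴ rung `BalabanLadder.UV` only — NOT continuum ∕ ℝ⁴ ∕ OS; the Yang–Mills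
mass gap (Clay) is NOT proved by any of this.

References: [Balaban1985Variational] (7) p.278, Thm 1 (8)–(9) p.279, Prop. 8 p.304; [Balaban1984PropagatorsII] (2.3) p.224; [Balaban1988Convergent] (2.1)–(2.2) p.254, (2.18) p.257, Thm 1
p.262; [Balaban1985RegularSpaces] Prop. 6 p.99; [Balaban1987RG1] (0.1) p.251, Thm 1 p.259, (2.9) p.266.
-/

noncomputable section

open MeasureTheory
open scoped Matrix.Norms.L2Operator

namespace Summit.QuantumFields.YangMills.Theorems.K0AllTorusOfStepTokensGuardedZBLamAx

open Literature.MathematicalPhysics.QuantumFieldTheory.Balaban1983to89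
open Literature.MathematicalPhysics.QuantumFieldTheory.Balaban1983to89.Node00
open Literature.MathematicalPhysics.QuantumFieldTheory.Balaban1983to89.T4Continuum
open Literature.MathematicalPhysics.QuantumFieldTheory.Balaban1983to89.FlowStep
open Literature.MathematicalPhysics.QuantumFieldTheory.Balaban1983to89.B15DeterminingSets
open Literature.MathematicalPhysics.QuantumFieldTheory.Balaban1983to89.B8LeafModelZd (ZdIdx)
open Summit.QuantumFields.YangMills.BalabanUVNodes.N07RecordDomainsAdm22 (blockSat_seqOfRecord)
open Summit.QuantumFields.YangMills.Theorems.K0V23Defs (Prop8StepCoPGridGBAt)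
open Summit.QuantumFields.YangMills.Theorems.K0V23DefsAx (AbsBetaBoxAtThm1WitnessCCMGenGridGZBAxAt AbsBetaBoxAtThm1WitnessCCMGenGridGZBEps0AxAt absBetaBoxGenGridGZBAxAt_of_eps0)

/-- **THE DATA TRANSFER AT PRINT's (7)**: on every prefix `(p, n, s)` with `n ≤ p.K` and torus-compatible 𝐃-partitions (`PartCompat₁₃Chi`), the support's reading-(b) clause
`Sect2.DataSmall7PTop` gives print's `dataSmall7LamTopOf F N` (P0 `dataSmall7LamTopOf_of_seq`; saturation from `blockSat_seqOfRecord`) — the `hDat` hypothesis of `…ZBLam` at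
`Dat := dataSmall7LamTopOf F N`, for every Stage-13 parameter. [cite: Balaban1985Variational, (7) p.278; Balaban1984PropagatorsII, (2.3) p.224; Balaban1988Convergent, (2.1)–(2.2) p.254, (2.18) p.257] -/
theorem hDat_dataSmall7LamTopOfAx (F : T4Family) (N : ℕ) [NeZero N] (θ : Stage13Params F N) (p : B12.RunParams) (n : ℕ)
    (s : SeqOfRecord F θ.ν θ.τ9.M (gOfRecord₁₃Ax F N θ p) p.K n) (δ : ℕ → ℝ) (W : MSField (F.P p.K) (SU N)) (hn : n ≤ p.K) (hpc : PartCompat₁₃Chi F N θ (chiβOfRecord₁₃Ax F N θ) p n)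
    (h7 : Sect2.DataSmall7PTop (avOfRecord F N p.K) s.Ω (suppDomOfRecord F θ.ν p.K s.Ω) n δ W) :
    dataSmall7LamTopOf F N p.K s.Ω (suppDomOfRecord F θ.ν p.K s.Ω) n δ W := by
  have hk : n ≤ (F.P p.K).m + (F.P p.K).K := by show n ≤ F.m + p.K; omega
  exact dataSmall7LamTopOf_of_seq s hk (blockSat_seqOfRecord F θ.ν θ.τ9.M (gOfRecord₁₃Ax F N θ p) p.K n hk s hpc) h7

variable {Efl logz : B12.RunParams → ℕ → ℝ}

/-- **★★★ K0⁷'s BODY AT EVERY FAMILY AT PRINT's DATUM AND PRINT's DATA PREDICATE, CONDITIONAL ON THE STAGE-2 SEAM ONLY** (plus the three CANDIDATE stub texts): `…ZBLam`'s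
`record13SepCoPHBody_of_stubs1GB_2P_3A'GBZBAx_lam` at `DatF := fun F => dataSmall7LamTopOf F 2`, `hDat` discharged by `hDat_dataSmall7LamTopOfAx`.  After the seam edit `hseam` is
`fun F θ p n s W => UbgOfRecord₁₃CoP_succ …` and this is the door a registered V23 skeleton's `…_of h1 h2 h3` cites.  CONDITIONAL; K0⁷ NOT closed; nothing of Bałaban asserted.
[cite: Balaban1985Variational, Thm 1 (8)–(9) p.279, (7) p.278, Prop. 8 p.304, p.304 lines 1–2; Balaban1985RegularSpaces, Prop. 6 p.99; Balaban1984PropagatorsII, (2.3) p.224; Balaban1988Convergent, Thm 1 p.262, (2.1) p.254, (2.18) p.257; Balaban1987RG1, Thm 1 p.259, (0.1) p.251] -/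
theorem record13SepCoPHBody_of_stubs1GBPrint_2P_3A'GBPrintZBAx_lam
    (hseam : ∀ (F : T4Family) (θ : Stage13Params F 2) (p : B12.RunParams) (n : ℕ) (s : SeqOfRecord F θ.ν θ.τ9.M (gOfRecord₁₃Ax F 2 θ p) p.K (n + 1)) (W : MSField (F.P p.K) (SU 2)),
      UbgOfRecord₁₃CoPChi F 2 θ (chiβOfRecord₁₃Ax F 2 θ) p (n + 1) s W = UbgMSCoPOfRecordB F 2 θ.ν θ.τ9.M (gOfRecord₁₃Ax F 2 θ p) p.K (n + 1) s W)
    (h1G : ∀ F : T4Family, ∃ (c c₀ c₁ : ℕ) (B₃ a₀ a₁ : ℝ), 2 * (F.L : ℝ) ^ 2 ≤ B₃ ∧ 0 < a₀ ∧ 0 < a₁ ∧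
      Prop8RegSepTopStepGB F 2 (fun ν K Ω => suppDomOfRecord F ν K Ω) (fun ν M g K k _s => c ≤ ν.M₁ ∧ k + c₀ ≤ F.m + K ∧ F.L ^ c₁ ∣ M ∧
      ∀ i, 1 ≤ i → i ≤ k → dCubeSide (F.P K).L M (RkOfRecord (F.P K).L ν.r (g i)) i ∣ (F.P K).sitesPerDir 0) (lamDatum F) (dataSmall7LamTopOf F 2) B₃ a₀ a₁)
    (h2P : ∀ F : T4Family, ∃ (ρ₀ : ℕ) (B₁ c₁ : ℝ), 1 ≤ ρ₀ ∧ 0 ≤ B₁ ∧ 0 < c₁ ∧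
      (letI : CStarAlgebra (MatA 2) := {}; B8.Prop6Printed 4 (F.L : ℝ) B₁ c₁ (fun i : ZdIdx 4 F.L => zdCubP (MatA 2) F.L ρ₀ i)))
    (h3A'G : ∀ (F : T4Family) (j c c₀ c₁ : ℕ) (B₃ B₃' a₀ a₁ : ℝ), c ≤ F.L ^ j → c₀ ≤ j + 1 → c₁ ≤ j → 2 * (F.L : ℝ) ^ 2 ≤ B₃ → 0 < B₃' → 0 < a₀ → 0 < a₁ →
      VariationalThm1RegSepCoP7MGB F 2 (fun ν M g K k _s => c ≤ ν.M₁ ∧ k + c₀ ≤ F.m + K ∧ F.L ^ c₁ ∣ M ∧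
      ∀ i, 1 ≤ i → i ≤ k → dCubeSide (F.P K).L M (RkOfRecord (F.P K).L ν.r (g i)) i ∣ (F.P K).sitesPerDir 0) (lamDatum F) (dataSmall7LamTopOf F 2) B₃ a₀ a₁ →
      Gauge9RegSepTopStepGB F 2 (fun ν K Ω => suppDomOfRecord F ν K Ω) (F.L ^ j) (fun ν M g K k _s => c ≤ ν.M₁ ∧ k + c₀ ≤ F.m + K ∧ F.L ^ c₁ ∣ M ∧
      ∀ i, 1 ≤ i → i ≤ k → dCubeSide (F.P K).L M (RkOfRecord (F.P K).L ν.r (g i)) i ∣ (F.P K).sitesPerDir 0) (lamDatum F) (dataSmall7LamTopOf F 2) B₃ B₃' a₀ a₁ →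
      ∃ γ₀ ε₀ ε₂₉ β' : ℝ, 0 < γ₀ ∧ 0 < ε₀ ∧ 0 < ε₂₉ ∧
        BetaLowerH (-β') γ₀ (betaOfRecord₁₃Ax F 2 (theta13OfThm1CCMWZBAx F 2 j (1 / 2) a₀ ε₀ ε₂₉ B₃ B₃' a₀ a₁ Efl logz)) ∧
        BetaUpperH β' γ₀ (betaOfRecord₁₃Ax F 2 (theta13OfThm1CCMWZBAx F 2 j (1 / 2) a₀ ε₀ ε₂₉ B₃ B₃' a₀ a₁ Efl logz))) :
    ∀ F : T4Family, ∃ θ : Stage13HParams F 2, θ.Provisos₁₃SepCoPHAx F 2 ∧ (θ.ZhUnity F 2 ∧ θ.SlotsNondegenerate₁₃Ax F 2) ∧ θ.Admissible F 2 :=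
  record13SepCoPHBody_of_stubs1GB_2P_3A'GBZBAx_lam (DatF := fun F => dataSmall7LamTopOf F 2)
    (fun F θ p n s δ W hn hpc h7 => hDat_dataSmall7LamTopOfAx F 2 θ p n s δ W hn hpc h7) hseam h1G h2P h3A'G

/-! ## §3. The seam at the re-centred carrier is `rfl`; the BY-NAME doors over the V24 texts -/

/-- POST-SEAM the re-centred seam IS `rfl` (`UbgOfRecord₁₃CoP_succ_chi` at `χ := chiβOfRecord₁₃Ax θ`): the `hseam` binder of every door below is dischargeable by this term.
[cite: Balaban1988Convergent, (2.12)–(2.13) pp.256–257; Balaban1984PropagatorsII, (2.3) p.224 (bookkeeping)] -/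
theorem hseamAx_rfl :
    ∀ (F : T4Family) (θ : Stage13Params F 2) (p : B12.RunParams) (n : ℕ) (s : SeqOfRecord F θ.ν θ.τ9.M (gOfRecord₁₃Ax F 2 θ p) p.K (n + 1)) (W : MSField (F.P p.K) (SU 2)),
      UbgOfRecord₁₃CoPChi F 2 θ (chiβOfRecord₁₃Ax F 2 θ) p (n + 1) s W = UbgMSCoPOfRecordB F 2 θ.ν θ.τ9.M (gOfRecord₁₃Ax F 2 θ p) p.K (n + 1) s W :=
  fun _ _ _ _ _ _ => rfl

/-- **K0ᴬ's BODY AT EVERY FAMILY from the V24 stub-1ᴮ text (= V23's, centre-blind), the stub-2′ text and the RE-CENTRED 3ᴬ′ᴮ text `K0V23DefsAx.AbsBetaBoxAtThm1WitnessCCMGenGridGZBAxAt`,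
CONDITIONAL ON THE SEAM** (σ-image of `K0V23Defs.k0Body_of_stub1B_of_2P_of_3B`; `hseam` is `hseamAx_rfl`).  CONDITIONAL; K0ᴬ NOT closed; nothing of Bałaban asserted.
[cite: Balaban1985Variational, Thm 1 (8)–(9) p.279, Prop. 8 p.304; Balaban1985RegularSpaces, Prop. 6 p.99; Balaban1988Convergent, Thm 1 p.262, (2.1) p.254; Balaban1987RG1, Thm 1 p.259, (2.9) p.266] -/
theorem k0BodyAx_of_stub1B_of_2P_of_3B
    (hseam : ∀ (F : T4Family) (θ : Stage13Params F 2) (p : B12.RunParams) (n : ℕ) (s : SeqOfRecord F θ.ν θ.τ9.M (gOfRecord₁₃Ax F 2 θ p) p.K (n + 1)) (W : MSField (F.P p.K) (SU 2)),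
      UbgOfRecord₁₃CoPChi F 2 θ (chiβOfRecord₁₃Ax F 2 θ) p (n + 1) s W = UbgMSCoPOfRecordB F 2 θ.ν θ.τ9.M (gOfRecord₁₃Ax F 2 θ p) p.K (n + 1) s W)
    (h1 : ∀ F : T4Family, Prop8StepCoPGridGBAt F)
    (h2P : ∀ F : T4Family, ∃ (ρ₀ : ℕ) (B₁ c₁ : ℝ), 1 ≤ ρ₀ ∧ 0 ≤ B₁ ∧ 0 < c₁ ∧
      (letI : CStarAlgebra (MatA 2) := {}; B8.Prop6Printed 4 (F.L : ℝ) B₁ c₁ (fun i : ZdIdx 4 F.L => zdCubP (MatA 2) F.L ρ₀ i)))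
    (h3 : ∀ F : T4Family, AbsBetaBoxAtThm1WitnessCCMGenGridGZBAxAt F) :
    ∀ F : T4Family, ∃ θ : Stage13HParams F 2, θ.Provisos₁₃SepCoPHAx F 2 ∧ (θ.ZhUnity F 2 ∧ θ.SlotsNondegenerate₁₃Ax F 2) ∧ θ.Admissible F 2 :=
  record13SepCoPHBody_of_stubs1GBPrint_2P_3A'GBPrintZBAx_lam hseam h1 h2P h3

/-- **K0ᴬ's BODY from the V24 stub-1ᴮ text, the stub-2′ text and the STRENGTHENED re-centred text** (through `K0V23DefsAx.absBetaBoxGenGridGZBAxAt_of_eps0`; σ-image of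
`K0V23Defs.k0Body_of_stub1B_of_2P_of_eps0B`).  CONDITIONAL; K0ᴬ NOT closed; nothing of Bałaban asserted. [cite: Balaban1985Variational, Thm 1 (8)–(9) p.279, Prop. 8 p.304; Balaban1985RegularSpaces, Prop. 6 p.99; Balaban1987RG1, Thm 1 p.259, (1.2) p.260] -/
theorem k0BodyAx_of_stub1B_of_2P_of_eps0B
    (hseam : ∀ (F : T4Family) (θ : Stage13Params F 2) (p : B12.RunParams) (n : ℕ) (s : SeqOfRecord F θ.ν θ.τ9.M (gOfRecord₁₃Ax F 2 θ p) p.K (n + 1)) (W : MSField (F.P p.K) (SU 2)),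
      UbgOfRecord₁₃CoPChi F 2 θ (chiβOfRecord₁₃Ax F 2 θ) p (n + 1) s W = UbgMSCoPOfRecordB F 2 θ.ν θ.τ9.M (gOfRecord₁₃Ax F 2 θ p) p.K (n + 1) s W)
    (h1 : ∀ F : T4Family, Prop8StepCoPGridGBAt F)
    (h2P : ∀ F : T4Family, ∃ (ρ₀ : ℕ) (B₁ c₁ : ℝ), 1 ≤ ρ₀ ∧ 0 ≤ B₁ ∧ 0 < c₁ ∧
      (letI : CStarAlgebra (MatA 2) := {}; B8.Prop6Printed 4 (F.L : ℝ) B₁ c₁ (fun i : ZdIdx 4 F.L => zdCubP (MatA 2) F.L ρ₀ i)))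
    (h3e : ∀ F : T4Family, AbsBetaBoxAtThm1WitnessCCMGenGridGZBEps0AxAt F) :
    ∀ F : T4Family, ∃ θ : Stage13HParams F 2, θ.Provisos₁₃SepCoPHAx F 2 ∧ (θ.ZhUnity F 2 ∧ θ.SlotsNondegenerate₁₃Ax F 2) ∧ θ.Admissible F 2 :=
  k0BodyAx_of_stub1B_of_2P_of_3B hseam h1 h2P fun F => absBetaBoxGenGridGZBAxAt_of_eps0 F (h3e F)

end Summit.QuantumFields.YangMills.Theorems.K0AllTorusOfStepTokensGuardedZBLamAx

end
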